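/-
Copyright (c) 2026. All rights reserved.
Released under Apache 2.0 license as described in the file LICENSE.
Authors: abc-iut cell — seat abc-iut-w4-d104 (gen 4): [AbsTopIII] Cor 2.8 — ONE closer for the node over
abc-iut-w5-d140's sub-DAG, with every analytic input as a named binder («COR28-BUNDLE»).
-/
import Literature.AnabelianGeometry.AbsoluteAnabelian.ArchimedeanReconstructionCor28AnalyticValues
import HarnessLib

/-!
# [AbsTopIII] Cor 2.8 «Galois-theoretic reconstruction of Aut-holomorphic spaces»: the node's closer from
# its two analytic inputs (AV) and «enough NF-rational functions»

S. Mochizuki, *Topics in absolute anabelian geometry III* (bib key `MochizukiAbsTopIII2015`), Cor 2.8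
pp.63–64: (a) `X^top` := equivalence classes of Cauchy sequences of NF-points with the topology of the
`N(U, f)`, "`X^top = X_v(k_v)`"; (b) the charts `f_U : U_X ⥲ U_v`, `𝒜_X(U_X) := f_U⁻¹ ∘ Aut^hol(U_v) ∘ f_U`,
and `𝒜_X` "the unique Aut-holomorphic structure that extends the pre-Aut-holomorphic structure determined
by the groups `𝒜_X(U_X)`".  PROOF-ONLY file (no definitions).

abc-iut-w5-d140's sub-DAG (p414194) isolates what (a)/(b) presuppose beyond the definitions of p408225:
row r6 «equivalence of Cauchy sequences IS an equivalence relation» needs ENOUGH NF-rational functions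
(`NFCurveData.HasPolarFunctions`: a function with a pole at a given NF-point and poles off a given finite set
— Riemann–Roch on `X`, Thm 1.9 (d)), proved there as `cauchyEquiv_equivalence`; row r11/r12 «`𝒜_X(U_X)` is
well defined and determines the structure on the charted opens» (`ReconstructsAutHolOnCharts`, the
repaired node statement after W-F10-6) needs bi-analytic transitions, reduced by abc-iut-w4-d104's p443613
to the analytic-values binder (AV).  This file states the node's closer with BOTH inputs as named binders:

* `NFCurveData.cor28_wellDefined_of_analyticInputs` — (AV) ∧ `HasPolarFunctions` ⟹ (a) the Cauchy
  equivalence is an `Equivalence` (so `X^top` is the quotient by an equivalence relation, as print says)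
  ∧ (b) `ReconstructsAutHolOnCharts D`.

What is NOT consumed and stays as typed statements of the sub-DAG: the comparison rows r8
(`AnalyticComparison.{CauchyConverges, EquivIffSameLimit, PointsAreLimits, TopologyAgrees}` — the clause
"`X^top = X_v(k_v)`" against the genuine analytic space, not constructible over the shim) and r11-existence
`ChartsCover`.  HONEST SCOPE: (AV) and `HasPolarFunctions` are NAMED inputs owed by Thm 1.9's `ArisesFrom`;
functoriality (p.64 l.9–12) record-only.  Refereed pre-IUT material; nothing here bears on the disputed
[IUTchIII] Cor. 3.12; typed ≠ endorsed.
-/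

noncomputable section

namespace Literature.AnabelianGeometry.AbsoluteAnabelian

namespace ArchimedeanReconstruction

open _root_.Filter _root_.Topology _root_.Set _root_.TopologicalSpace

variable {D : NFCurveData}

/-- **[AbsTopIII] Cor 2.8, the node's closer from its analytic inputs**: if (AV) the genuine extended values
of the NF-rational functions are `k_v`-analytic in every Cor 2.8 (b) chart coordinate, and (r6) there are
enough NF-rational functions (`HasPolarFunctions`), then (a) "equivalence" of Cauchy sequences of NF-points
is an equivalence relation — `X^top` is a genuine quotient — and (b) the groups `𝒜_X(U_X)` are chart
independent and pin an Aut-holomorphic structure on the charted connected opens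
(`ReconstructsAutHolOnCharts`, abc-iut-w5-d140's repaired node statement).
[cite: MochizukiAbsTopIII2015, Corollary 2.8 pp.63–64] -/
theorem NFCurveData.cor28_wellDefined_of_analyticInputs
    (hAV : ∀ (UX : Opens D.Xtop) (c : D.Chart UX) (f : D.Fn) (x : D.Xtop) (hx : x ∈ UX),
      (∃ a : D.kv, Tendsto (fun j => D.valv f ((Quot.out x).1 j)) atTop (𝓝 a)) →
      ∃ F : D.kv → D.kv, AnalyticAt D.kv F ((c.fU ⟨x, hx⟩ : c.Uv) : D.kv) ∧
        ∀ᶠ u in 𝓝 x, ∀ hu : u ∈ UX,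
          limUnder atTop (fun j => D.valv f ((Quot.out u).1 j)) = F ((c.fU ⟨u, hu⟩ : c.Uv) : D.kv))
    (hP : D.HasPolarFunctions) :
    Equivalence (fun x y : {x : ℕ → D.Pt // D.IsCauchy x} => D.CauchyEquiv x.1 y.1) ∧
      D.ChartAutIndependent ∧ D.ReconstructsAutHolOnCharts :=
  ⟨NFCurveData.cauchyEquiv_equivalence D hP, NFCurveData.chartAutIndependent_of_analyticValues hAV,
    NFCurveData.reconstructsAutHolOnCharts_of_analyticValues hAV⟩

end ArchimedeanReconstruction

end Literature.AnabelianGeometry.AbsoluteAnabelian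

end
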